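import Summits.BirchSwinnertonDyer.BirchSwinnertonDyer.Theorems.GenusKolyvaginAtTwoVisiblePairAtTwoHeegnerLocal
import Summits.BirchSwinnertonDyer.BirchSwinnertonDyer.Theorems.GenusKolyvaginAtTwoEquivariantKolyvaginExactAtTwoVisiblePairInputReductionsSplit
import Summits.BirchSwinnertonDyer.BirchSwinnertonDyer.Theorems.GenusKolyvaginAtTwoEquivariantKolyvaginExactAtTwoSelmerDescentTwoTorsion
import Summits.BirchSwinnertonDyer.BirchSwinnertonDyer.Theorems.GenusKolyvaginAtTwoEquivariantKolyvaginExactAtTwoSelmerDescentInert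
import Summits.BirchSwinnertonDyer.BirchSwinnertonDyer.Theorems.GenusKolyvaginAtTwoMazurRubinCor34iiDictionary
import HarnessLib

/-!
# Route `GenusKolyvaginAtTwo`, LINE 6, KEY crux Q3 (inner statement of stmt-BirchSwinnertonDyer-22137):
# the displayed Lemma-4.3 inputs of the pair instance `VisiblePairAtTwo.Input` REDUCED TO THE `K`-STATEMENT on the
# Heegner habitat — every place of `ℚ`, both members, modulo only the arithmetic DEF-free condition `E(ℚ_v)[2] = 0`
# at `v ∣ d_K`

Helper (seat `bsd-line-gk2-p3` g13; `--supports` the crux, closes nothing). Final assembly of this lineage's place-by-place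
transfers of McCallum's Lemma 4.3 from `K` to `ℚ` for the descended Kolyvagin classes of the pair `(E, E^{(d_K)})` at
`2` (the fields `Input.loc_c₁_fin`, `Input.loc_c₂_fin` of `…VisiblePairAtTwoDefs`; `loc_c₁_inf`, `loc_c₂_inf` are free on
`Δ < 0`, `…VisiblePairInputReductions`). At a finite place `v ∤ m` of `ℚ`:

* `√d_K ∈ ℚ_v` (every `v ∣ N`, Heegner; `v = 2` if `d_K ≡ 1 mod 8`): `…SelmerDescentSplit` (any reduction, any level);
* `v ∣ d_K` (odd, ramified): `…SelmerDescentTwoTorsion` — iff-free transfer from `#E(ℚ_v)[2] = 1` (Tate duality count),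
  for the twin from `#E^{(d_K)}(ℚ_v)[2] = #E(ℚ_v)[2]` (`GenusKolyTwistTamagawa.natCard_torsionBy_two_quadraticTwist`);
* `√d_K ∉ ℚ_v`, `v ∤ d_K` (inert; incl. `v = 2`, `d_K ≡ 5 mod 8`): `E` and `E^{(d_K)}` are GOOD at `v`
  (`…VisiblePairAtTwoHeegnerLocal`: Heegner + Hensel, twist by `d_K ≡ 1 mod 4`) and `…SelmerDescentInert` (Milne I.3.8, any
  level).

Results (`K` quadratic, `d_K` odd, `SatisfiesHeegnerHypothesis N_E K`, `K = ℚ(θ)`, `θ² = d_K`):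

* `natCard_ker_two_twin_adicCompletion_eq` — `#E^{(d_K)}(ℚ_v)[2] = #E(ℚ_v)[2]`;
* `mem_selmerLocalKer_of_K_of_heegner` / `mem_selmerLocalKer_twin_of_K_of_heegner` — ONE place, member `E` / `E^{(d_K)}`:
  the ℚ-level Selmer condition at `v` from the `K`-level condition at the places above `v`, given
  `v ∣ d_K → #E(ℚ_v)[2] = 1`;
* `loc_c₁_fin_of_K_of_heegner`, `loc_c₂_fin_of_K_of_heegner` — **the fields `Input.loc_c₁_fin`, `Input.loc_c₂_fin` from:
  Lemma 4.3 OVER `K` for `c_K(m)` at `w ∤ m`, the descent identities, and the DEF-free condition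
  `∀ v ∣ d_K, #E(ℚ_v)[2] = 1`** — no other ℚ-hypothesis remains.

So the honest hypotheses of the ℚ-pair form of Q3-inner (the record `Input`) are now: the classes with their descent
identities, `rel` (= Q2 `KolyvaginRelationAtTwo` over `K`), Lemma 4.3 over `K`, (H2) `sel_visible`, and DEF-freeness
(`cebotarev` is gk2-p2's `input_cebotarev`). THEOREMS ONLY (no definition, no named fact, no `sorry`, standard axioms).
BSD is not proved by any of this.

References: [McCallumLMS1991] §4 Lemma 4.3; [GrossLMS1991] §3 (3.1), Prop. 6.2 (1); [Kolyvagin1989Izv] §3 (the pair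
`(E, E^D)`, criterion `B_2(E, D)`); [MilneADT2006] I Thm. 3.2, Prop. 3.8; [MazurRubin2010] Remark 2.4.
-/

set_option autoImplicit false
set_option linter.dupNamespace false -- tree convention: `Summit.BirchSwinnertonDyer.BirchSwinnertonDyer.Theorems` (summit = sub-problem)

noncomputable section

open scoped Classical

namespace Summit.BirchSwinnertonDyer.BirchSwinnertonDyer.Theorems.GenusExact.VisiblePairAtTwo

open WeierstrassCurve NumberField IsDedekindDomain Field Rat.HeightOneSpectrum
open Literature.NumberTheory.EllipticCurves Literature.NumberTheory.GaloisRepresentations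
open Literature.NumberTheory.EllipticCurves.KolyvaginDescent
open Summit.BirchSwinnertonDyer.BirchSwinnertonDyer.Theorems.GenusExact.SelmerDescent

variable {K : Type} [Field K] [NumberField K] (W : WeierstrassCurve ℚ) [W.IsElliptic]

/-! ## §1 The twin's local `2`-torsion is that of `E` -/

omit [NumberField K] [W.IsElliptic] in
/-- `#ker [2] = #A[2]` (the two spellings of the `2`-torsion of an abelian group). [folklore] -/
theorem natCard_ker_two_eq_natCard_torsionBy {A : Type*} [AddCommGroup A] :
    Nat.card (nsmulAddMonoidHom 2 : A →+ A).ker = Nat.card (AddSubgroup.torsionBy A (2 : ℤ)) := by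
  rw [GenusKolyLowering.ker_nsmulAddMonoidHom_eq_torsionBy]
  rfl

/-- **`#E^{(d_K)}(ℚ_v)[2] = #E(ℚ_v)[2]`** at every place `v` of `ℚ` (`E^{(d_K)}[2] ≅ E[2]` as Galois modules; on points:
the roots of the `2`-division cubics correspond under `x ↦ d_K x`, the lead's
`GenusKolyTwistTamagawa.natCard_torsionBy_two_quadraticTwist` over the field `ℚ_v`, base change commuting with the
twist). So the DEF-free condition at `v ∣ d_K` reads the same for both members of the pair. (No `CharZero ℚ_v`
instance is put in scope: it would let `DivisionRing.toRatAlgebra` compete with the `ℚ`-algebra structure of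
`adicCompletion` inside `baseChange`.) [cite: MazurRubin2010, Remark 2.4] [cite: SilvermanAEC2009, X.5 Cor. 5.4] -/
theorem natCard_ker_two_twin_adicCompletion_eq (v : HeightOneSpectrum (𝓞 ℚ)) :
    Nat.card (nsmulAddMonoidHom 2 : ((twin W K).baseChange (v.adicCompletion ℚ)).toAffine.Point →+ _).ker =
      Nat.card (nsmulAddMonoidHom 2 : (W.baseChange (v.adicCompletion ℚ)).toAffine.Point →+ _).ker := by
  haveI : NeZero (2 : v.adicCompletion ℚ) := ⟨by
    haveI : CharZero (v.adicCompletion ℚ) :=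
      charZero_of_injective_algebraMap (algebraMap ℚ (v.adicCompletion ℚ)).injective
    exact two_ne_zero⟩
  haveI : (W.baseChange (v.adicCompletion ℚ)).IsElliptic :=
    inferInstanceAs (W.map (algebraMap ℚ (v.adicCompletion ℚ))).IsElliptic
  have hd : algebraMap ℚ (v.adicCompletion ℚ) ((NumberField.discr K : ℤ) : ℚ) ≠ 0 :=
    (map_ne_zero _).mpr (by exact_mod_cast NumberField.discr_ne_zero K)
  rw [natCard_ker_two_eq_natCard_torsionBy, natCard_ker_two_eq_natCard_torsionBy]
  have htw : (twin W K).baseChange (v.adicCompletion ℚ) =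
      (W.baseChange (v.adicCompletion ℚ)).quadraticTwist
        (algebraMap ℚ (v.adicCompletion ℚ) ((NumberField.discr K : ℤ) : ℚ)) :=
    baseChange_quadraticTwist W (v.adicCompletion ℚ) _
  have key : ∀ X Y : WeierstrassCurve (v.adicCompletion ℚ), X = Y →
      Nat.card (AddSubgroup.torsionBy X.toAffine.Point (2 : ℤ)) =
        Nat.card (AddSubgroup.torsionBy Y.toAffine.Point (2 : ℤ)) := fun X Y h ↦ h ▸ rfl
  rw [key _ _ htw]
  exact GenusKolyTwistTamagawa.natCard_torsionBy_two_quadraticTwist (W.baseChange (v.adicCompletion ℚ)) hd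

/-! ## §2 One place at a time, on the Heegner habitat -/

/-- **Member `E`, one finite place `v`, on the Heegner habitat** (`K = ℚ(θ)` quadratic, `θ² = d_K` odd, every `p ∣ N_E`
split in `K`): the ℚ-level Selmer condition of `u` at `v` from the `K`-level condition of `c_K = res u` at the places
above `v`, given only `v ∣ d_K → #E(ℚ_v)[2] = 1`. Three cases: `√d_K ∈ ℚ_v` (`…SelmerDescentSplit`); `v ∣ d_K`
(`…SelmerDescentTwoTorsion`); else `E` is good at `v` (Heegner, `…HeegnerLocal`) and `v` is unramified
(`…SelmerDescentInert`, `d_K ≡ 1 mod 4`). Any level `n`. [cite: McCallumLMS1991, §4 Lemma 4.3]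
[cite: Kolyvagin1989Izv, §3] -/
theorem mem_selmerLocalKer_of_K_of_heegner (h2 : Module.finrank ℚ K = 2) {θ : K}
    (hθ : θ ∉ (algebraMap ℚ K).range) (hθsq : θ ^ 2 = algebraMap ℚ K ((NumberField.discr K : ℤ) : ℚ))
    (hodd : Odd (NumberField.discr K)) (hH : SatisfiesHeegnerHypothesis (W.conductorNorm ℤ) K) (n : ℤ)
    {u : galH1Torsion W n} {cK : galH1Torsion (W.baseChange K) n} (hu : resTorsion W K n u = cK)
    (v : HeightOneSpectrum (𝓞 ℚ))
    (htors : ((NumberField.discr K : ℤ) : 𝓞 ℚ) ∈ v.asIdeal →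
      Nat.card (nsmulAddMonoidHom 2 : (W.baseChange (v.adicCompletion ℚ)).toAffine.Point →+ _).ker = 1)
    (hK : ∀ (w : HeightOneSpectrum (𝓞 K)) [w.asIdeal.LiesOver v.asIdeal],
      cK ∈ selmerLocalKer (W.baseChange K) (w.adicCompletion K) n) :
    u ∈ selmerLocalKer W (v.adicCompletion ℚ) n := by
  by_cases hsq : ∃ s : v.adicCompletion ℚ, s ^ 2 = algebraMap ℚ (v.adicCompletion ℚ) (NumberField.discr K : ℤ)
  · exact mem_selmerLocalKer_of_K_of_sq W h2 hθ hθsq n hu v hsq hK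
  by_cases hdv : ((NumberField.discr K : ℤ) : 𝓞 ℚ) ∈ v.asIdeal
  · exact mem_selmerLocalKer_of_K_of_natCard_two_torsion_eq_one W h2 n hu v (two_notMem_of_odd_of_mem v hodd hdv)
      (htors hdv) hK
  · have h4 : NumberField.discr K % 4 = 1 :=
      (TwinGrossPrimes.discr_emod_four_eq_one_and_squarefree_of_odd (K := K) h2 hodd).1
    have hdk : NumberField.discr K = 1 + 4 * (NumberField.discr K / 4) := by omega
    exact mem_selmerLocalKer_of_K_of_one_add_four_mul W h2 hθ hdk hθsq n hu v
      (hasGoodReductionAt_of_heegner_of_not_exists_sq W h2 hodd hH v hsq) hdv hK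

omit [W.IsElliptic] in
/-- **Member `E^{(d_K)}`, one finite place `v`, on the Heegner habitat** (the twin read through `hPsiKT`): the ℚ-level
Selmer condition of `y` at `v` from the `K`-level condition of `c_K = hPsiKT (res y)` at the places above `v`, given only
`v ∣ d_K → #E^{(d_K)}(ℚ_v)[2] = 1`. Cases as for `E`; in the inert case the twin is good at `v` since `d_K ≡ 1 (mod 4)`
(`hasGoodReductionAt_twin_of_heegner_of_not_exists_sq`). Any level `n`. [cite: McCallumLMS1991, §4 Lemma 4.3]
[cite: Kolyvagin1989Izv, §3] -/
theorem mem_selmerLocalKer_twin_of_K_of_heegner [W.IsElliptic] (h2 : Module.finrank ℚ K = 2) {θ : K}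
    (hθ : θ ∉ Set.range (algebraMap ℚ K)) (hθsq : θ ^ 2 = algebraMap ℚ K ((NumberField.discr K : ℤ) : ℚ))
    (hodd : Odd (NumberField.discr K)) (hH : SatisfiesHeegnerHypothesis (W.conductorNorm ℤ) K)
    [(twin W K).IsElliptic] (n : ℤ) {y : galH1Torsion (twin W K) n} {cK : galH1Torsion (W.baseChange K) n}
    (hy : hPsiKT W K hθ hθsq n (resTorsion (twin W K) K n y) = cK) (v : HeightOneSpectrum (𝓞 ℚ))
    (htors : ((NumberField.discr K : ℤ) : 𝓞 ℚ) ∈ v.asIdeal →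
      Nat.card (nsmulAddMonoidHom 2 : ((twin W K).baseChange (v.adicCompletion ℚ)).toAffine.Point →+ _).ker = 1)
    (hK : ∀ (w : HeightOneSpectrum (𝓞 K)) [w.asIdeal.LiesOver v.asIdeal],
      cK ∈ selmerLocalKer (W.baseChange K) (w.adicCompletion K) n) :
    y ∈ selmerLocalKer (twin W K) (v.adicCompletion ℚ) n := by
  by_cases hsq : ∃ s : v.adicCompletion ℚ, s ^ 2 = algebraMap ℚ (v.adicCompletion ℚ) (NumberField.discr K : ℤ)
  · exact mem_selmerLocalKer_twin_of_K_of_sq W h2 (not_mem_range hθ) hθsq hθ hθsq n hy v hsq hK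
  by_cases hdv : ((NumberField.discr K : ℤ) : 𝓞 ℚ) ∈ v.asIdeal
  · exact mem_selmerLocalKer_twin_of_K_of_natCard_two_torsion_eq_one W h2 hθ hθsq n hy v
      (two_notMem_of_odd_of_mem v hodd hdv) (htors hdv) hK
  · have h4 : NumberField.discr K % 4 = 1 :=
      (TwinGrossPrimes.discr_emod_four_eq_one_and_squarefree_of_odd (K := K) h2 hodd).1
    have hdk : NumberField.discr K = 1 + 4 * (NumberField.discr K / 4) := by omega
    exact mem_selmerLocalKer_twin_of_K_of_one_add_four_mul W h2 (not_mem_range hθ) hdk hθsq hθ hθsq n hy v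
      (hasGoodReductionAt_twin_of_heegner_of_not_exists_sq W h2 hodd hH v hdv hsq) hdv hK

/-! ## §3 The `Input` fields `loc_c₁_fin`, `loc_c₂_fin` from the `K`-statement and DEF-freeness -/

section Fields

variable [W.IsGloballyMinimal] {M : ℕ} {θ : K} (hθ : θ ∉ Set.range (algebraMap ℚ K))
  (hθsq : θ ^ 2 = algebraMap ℚ K ((NumberField.discr K : ℤ) : ℚ))

include hθ hθsq in
/-- **`Input.loc_c₁_fin` from Lemma 4.3 over `K` on the Heegner habitat**: for the member `E`, the Selmer condition of
the descended classes `c₁ m` at every finite place `v ∤ m` of `ℚ` follows from Lemma 4.3 OVER `K` for `c_K(m)` at the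
places `w ∤ m` (`hK43`), the descent identities `res (c₁ m) = c_K(m)` (`hres`), and the DEF-free condition in arithmetic
form `∀ v ∣ d_K, #E(ℚ_v)[2] = 1` (`htors`) — NO other ℚ-hypothesis (`K` quadratic, `d_K` odd, Heegner hypothesis for
`N_E`). [cite: McCallumLMS1991, §4 Lemma 4.3] [cite: Kolyvagin1989Izv, §3 (criterion B_2(E, D))] -/
theorem loc_c₁_fin_of_K_of_heegner (h2 : Module.finrank ℚ K = 2) (hodd : Odd (NumberField.discr K))
    (hH : SatisfiesHeegnerHypothesis (W.conductorNorm ℤ) K) (c₁ : ℕ → galH1Torsion W (lvl M))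
    (cK : ℕ → galH1Torsion (W.baseChange K) (lvl M))
    (hres : ∀ m, KolSupp (kolPrime W K M) m → Even m.primeFactors.card →
      resTorsion W K (lvl M) (c₁ m) = cK m)
    (hK43 : ∀ m, KolSupp (kolPrime W K M) m → ∀ w : HeightOneSpectrum (𝓞 K), (m : 𝓞 K) ∉ w.asIdeal →
      cK m ∈ selmerLocalKer (W.baseChange K) (w.adicCompletion K) (lvl M))
    (htors : ∀ v : HeightOneSpectrum (𝓞 ℚ), ((NumberField.discr K : ℤ) : 𝓞 ℚ) ∈ v.asIdeal →
      Nat.card (nsmulAddMonoidHom 2 : (W.baseChange (v.adicCompletion ℚ)).toAffine.Point →+ _).ker = 1) :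
    ∀ m, KolSupp (kolPrime W K M) m → Even m.primeFactors.card → ∀ v : HeightOneSpectrum (𝓞 ℚ),
      (m : 𝓞 ℚ) ∉ v.asIdeal → c₁ m ∈ selmerLocalKer W (v.adicCompletion ℚ) (lvl M) := fun m hm hev v hmv ↦
  mem_selmerLocalKer_of_K_of_heegner W h2 (not_mem_range hθ) hθsq hodd hH (lvl M) (hres m hm hev) v (htors v)
    (fun w _ ↦ hK43 m hm w (intCast_notMem_of_liesOver K v w (n := (m : ℤ)) (by exact_mod_cast hmv) |>
      fun h ↦ by exact_mod_cast h))

include hθ hθsq in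
omit [W.IsElliptic] in
/-- **`Input.loc_c₂_fin` from Lemma 4.3 over `K` on the Heegner habitat**: for the twin `E^{(d_K)}`, the Selmer condition
of `c₂ m` at every finite place `v ∤ m` follows from Lemma 4.3 OVER `K` for `c_K(m)`, the descent identities
`hPsiKT (res (c₂ m)) = c_K(m)`, and the SAME DEF-free condition `∀ v ∣ d_K, #E(ℚ_v)[2] = 1` (read on the twin by §1).
[cite: McCallumLMS1991, §4 Lemma 4.3] [cite: Kolyvagin1989Izv, §3 (criterion B_2(E, D))] -/
theorem loc_c₂_fin_of_K_of_heegner [W.IsElliptic] (h2 : Module.finrank ℚ K = 2) (hodd : Odd (NumberField.discr K))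
    (hH : SatisfiesHeegnerHypothesis (W.conductorNorm ℤ) K) [(twin W K).IsElliptic]
    (c₂ : ℕ → galH1Torsion (twin W K) (lvl M)) (cK : ℕ → galH1Torsion (W.baseChange K) (lvl M))
    (hres : ∀ m, KolSupp (kolPrime W K M) m → Odd m.primeFactors.card →
      hPsiKT W K hθ hθsq (lvl M) (resTorsion (twin W K) K (lvl M) (c₂ m)) = cK m)
    (hK43 : ∀ m, KolSupp (kolPrime W K M) m → ∀ w : HeightOneSpectrum (𝓞 K), (m : 𝓞 K) ∉ w.asIdeal →
      cK m ∈ selmerLocalKer (W.baseChange K) (w.adicCompletion K) (lvl M))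
    (htors : ∀ v : HeightOneSpectrum (𝓞 ℚ), ((NumberField.discr K : ℤ) : 𝓞 ℚ) ∈ v.asIdeal →
      Nat.card (nsmulAddMonoidHom 2 : (W.baseChange (v.adicCompletion ℚ)).toAffine.Point →+ _).ker = 1) :
    ∀ m, KolSupp (kolPrime W K M) m → Odd m.primeFactors.card → ∀ v : HeightOneSpectrum (𝓞 ℚ),
      (m : 𝓞 ℚ) ∉ v.asIdeal → c₂ m ∈ selmerLocalKer (twin W K) (v.adicCompletion ℚ) (lvl M) :=
  fun m hm hodd' v hmv ↦
  mem_selmerLocalKer_twin_of_K_of_heegner W h2 hθ hθsq hodd hH (lvl M) (hres m hm hodd') v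
    (fun hdv ↦ (natCard_ker_two_twin_adicCompletion_eq W v).trans (htors v hdv))
    (fun w _ ↦ hK43 m hm w (intCast_notMem_of_liesOver K v w (n := (m : ℤ)) (by exact_mod_cast hmv) |>
      fun h ↦ by exact_mod_cast h))

end Fields

end Summit.BirchSwinnertonDyer.BirchSwinnertonDyer.Theorems.GenusExact.VisiblePairAtTwo

end
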